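import Summits.SmoothPoincare4.SmoothPoincare4.Theorems.DottedCircleRasmussenDcrGapHelperFriendsCarrierTkAux2
import Summits.SmoothPoincare4.SmoothPoincare4.Theorems.DottedCircleRasmussenDcrGapHelperFriendsCarrierVkCollarChart
import Summits.SmoothPoincare4.SmoothPoincare4.Theorems.DottedCircleRasmussenDcrGapHelperFriendsCarrierVkBandDisc
import Summits.SmoothPoincare4.SmoothPoincare4.Theorems.DottedCircleRasmussenDcrGapHelperFriendsCarrierExterior
import Literature.Topology.FourManifolds.SliceDiscEndCollar

/-!
# Helper `helper_friendsCarrier_Vk_partC` (V_k part C: the collar of the uninverted model disc exterior) —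
# piece 1: the collar datum and the definitions of the port
(item stmt-SmoothPoincare4-16128, route route-SmoothPoincare4-DottedCircleRasmussen)

Start of the port of the tree's `SliceDiscEndCollar.lean` (`k = 0`: the end collar of the exterior
`B̊⁴ ∖ Δ` of a conical slice disc) to the model `M_k = ∂D_k ⊂ ℝ⁴` of the line `mk_friends`
(stub `helper_friendsCarrier_Vk`, part C).  The dictionary: the radial structure `z = t • a`, `a ∈ S³`,
of the ball near its boundary sphere is replaced by the FLOW CHART `y = Φ(s, a)`, `a ∈ M_k`, `|s| < 2ε`,
of a clocked complete flow `Φ` of `ℝ⁴` (`G_k(Φ(s, a)) = 1 + s`, `helper_friendsCarrier_Vk_collarChart`):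
depth `1 - ‖z‖ ↦ G_k y - 1`, direction `z/‖z‖ ↦ drop y = Φ(1 - G_k y, y)`, cone `t • ν(u, w) ↦
Φ(1 - t, ν(u, w))`, tube coordinates `ν.toHomeo.symm ↦ ι` (`helper_friendsCarrier_Tk_tubeChart`).

* `FriendsVk.CollarDatum k` — the hypothesis block of part C, bundled: the flow `Φ` with its clock and
  band clauses, the model slice disc `g` (a flow line near the circle), the trivialised tube `G` of the
  open disc (the flow-out of the tube `ν` of `K₁` over the band, deep part off the thin shell), and tube
  coordinates `ι` on the flow-out of `ν`;
* `FriendsVk.clock_of_clock` — the clock of the flow on the whole band (the `TraceDatum.clock` shape of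
  `…TkAux3`, with `δ = 2ε`) from the clock along `M_k` and the band clause, so that
  `helper_friendsCarrier_Tk_tubeChart` applies; `CollarDatum.datumOf` — the datum assembled from the
  hypotheses of part C (tube coordinates by choice);
* ALL the definitions of the port, with the dictionary applied (no lemmas — those follow in the next pieces):
  the flow chart of the band (`band`, `depth`, `drop`, `shell s = Φ((0, s) × M_k)`); the tube neighbourhood
  `N` of the open disc with its inverse chart `Ginv`, the closed unit tube, the disc; the three collar formulas
  — SHELL `cRad (a, σ) = Φ(ℓ, a)`, `ℓ = Einv s₀ e^{-σ}` (template: radial `(1 - ℓ) • a`), TUBE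
  `cTube = G((1 - ℓ) u, r ŵ)`, `(ℓ, r) = Ψ⁻¹(‖w‖, σ)` (profile `SliceCollar.Ψ` verbatim), FLAT
  `cFlat = G(4p, Einv 1 e^{-σ} • v)` — and `collar`; the inverse formulas `ΨRad`, `ΨTube`, `ΨFlat`,
  `collarInv`; the collar region, the exterior `O = ℝ⁴ ∖ (D_k ∪ Δ)`, the size function `M = ρ + χ`;
  coordinate/regime sets; `Pres Y` — the smooth presentation of `Y` as `M_k` surgered along `K₁` through `ν`
  (the `Y`-side hypothesis block of part C, bundled);
* `helper_friendsCarrier_Vk_partC_clock` — the registered summary (band clock and `D_k` along the flow-out).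

The definitions are constructions (ports of the template's), not named facts; no `sorry`.
References: Manolescu–Piccirillo (2023), §3.2, proof of Lemma 3.3 [ManolescuPiccirillo2023];
Kosinski (1993), Ch. VI §5 [Kosinski1993]; the tree's `SliceDiscEndCollar.lean`.
-/

-- the prescribed namespace `Summit.<P>.<Sub>.…` duplicates `SmoothPoincare4` (P = Sub)
set_option linter.dupNamespace false
set_option linter.style.longLine false

noncomputable section

open scoped Manifold ContDiff Topology
open Function Set Metric
open Literature.Topology.FourManifolds Literature.Topology.FourManifolds.MMSW

namespace Summit.SmoothPoincare4.SmoothPoincare4.Theorems.DcrGap.MkFriends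

namespace FriendsVk

/-- **Collar datum** of the uninverted model disc exterior (the hypothesis block of
`helper_friendsCarrier_Vk_partC`, bundled): a clocked complete flow `Φ` of `ℝ⁴` along `M_k`, a model
slice disc `g` of the model knot `K₁` which is the flow line `g(t u) = Φ(1 - t, K₁ u)` near the circle, a
`C^∞` injective tube `ν : 𝕊¹ × ℝ² → M_k` with zero section `K₁`, a trivialised tube `G` of the open disc
off `D_k` which over the band is the flow-out `G(t u, w) = Φ(1 - t, ν(u, w))` and whose deep part misses
the thin shell `Φ((0, s₀) × M_k)`, and tube coordinates `ι` on the flow-out of `ν`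
(`helper_friendsCarrier_Tk_tubeChart`). [folklore] -/
structure CollarDatum (k : ℕ) where
  /-- the model knot -/
  K₁ : (Metric.sphere (0 : EuclideanSpace ℝ (Fin 2)) 1) → EuclideanSpace ℝ (Fin 4)
  /-- the clocked flow of `ℝ⁴` along `M_k` -/
  Φ : ℝ × (EuclideanSpace ℝ (Fin 4)) → EuclideanSpace ℝ (Fin 4)
  /-- the half clock range is `2ε` -/
  ε : ℝ
  /-- the width of the flow band of the disc -/
  s₁ : ℝ
  /-- the depth of the thin shell missed by the deep tube -/
  s₀ : ℝ
  /-- the model slice disc -/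
  g : (EuclideanSpace ℝ (Fin 2)) → EuclideanSpace ℝ (Fin 4)
  /-- the trivialised tube of the open disc -/
  G : (EuclideanSpace ℝ (Fin 2)) × (EuclideanSpace ℝ (Fin 2)) → EuclideanSpace ℝ (Fin 4)
  /-- the tube of the knot in `M_k` -/
  ν : (Metric.sphere (0 : EuclideanSpace ℝ (Fin 2)) 1) × (EuclideanSpace ℝ (Fin 2)) → EuclideanSpace ℝ (Fin 4)
  /-- tube coordinates on the flow-out of `ν` -/
  ι : (EuclideanSpace ℝ (Fin 4)) → (Metric.sphere (0 : EuclideanSpace ℝ (Fin 2)) 1) × (EuclideanSpace ℝ (Fin 2))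
  isModelKnot : IsModelKnot k K₁
  contDiff_Φ : ContDiff ℝ ∞ Φ
  Φ_zero : ∀ x, Φ (0, x) = x
  Φ_add : ∀ s t x, Φ (s, Φ (t, x)) = Φ (s + t, x)
  ε_pos : 0 < ε
  ε_le : ε ≤ 1 / 4
  clock : ∀ x ∈ modelBoundary k, ∀ s : ℝ, |s| ≤ 2 * ε →
    (∀ j, (1 : ℝ) / 2 < holeTerm k j (Φ (s, x))) ∧ levelFun k (Φ (s, x)) = 1 + s
  band_mem : ∀ y, (∀ j, 0 < holeTerm k j y) → |levelFun k y - 1| < 2 * ε → Φ (1 - levelFun k y, y) ∈ modelBoundary k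
  s₀_pos : 0 < s₀
  s₀_lt : s₀ < s₁
  s₁_lt : s₁ < 2 * ε
  isModelSliceDisc : IsModelSliceDisc k K₁ g
  g_cone : ∀ (u : (Metric.sphere (0 : EuclideanSpace ℝ (Fin 2)) 1)) (t : ℝ), 1 - s₁ ≤ t → t ≤ 1 → g (t • (u : EuclideanSpace ℝ (Fin 2))) = Φ (1 - t, K₁ u)
  contDiffOn : ContDiffOn ℝ ∞ G (ball (0 : EuclideanSpace ℝ (Fin 2)) 1 ×ˢ ball (0 : EuclideanSpace ℝ (Fin 2)) 2)
  injOn : InjOn G (ball (0 : EuclideanSpace ℝ (Fin 2)) 1 ×ˢ ball (0 : EuclideanSpace ℝ (Fin 2)) 2)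
  injective_fderiv : ∀ q ∈ ball (0 : EuclideanSpace ℝ (Fin 2)) 1 ×ˢ ball (0 : EuclideanSpace ℝ (Fin 2)) 2, Injective (fderiv ℝ G q)
  not_mem : ∀ q ∈ ball (0 : EuclideanSpace ℝ (Fin 2)) 1 ×ˢ ball (0 : EuclideanSpace ℝ (Fin 2)) 2, G q ∉ modelHandlebody k
  apply_zero : ∀ x ∈ ball (0 : EuclideanSpace ℝ (Fin 2)) 1, G (x, 0) = g x
  cone : ∀ (u : (Metric.sphere (0 : EuclideanSpace ℝ (Fin 2)) 1)) (t : ℝ) (w : EuclideanSpace ℝ (Fin 2)), 1 - s₁ < t → t < 1 → ‖w‖ < 2 →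
    G (t • (u : EuclideanSpace ℝ (Fin 2)), w) = Φ (1 - t, ν (u, w))
  deep : ∀ (x w : EuclideanSpace ℝ (Fin 2)), ‖x‖ ≤ 1 - s₀ → ‖w‖ < 2 → ∀ a ∈ modelBoundary k, ∀ s : ℝ, 0 < s → s < s₀ → G (x, w) ≠ Φ (s, a)
  contMDiff_ν : ContMDiff ((𝓡 1).prod 𝓘(ℝ, EuclideanSpace ℝ (Fin 2))) 𝓘(ℝ, EuclideanSpace ℝ (Fin 4)) ∞ ν
  injective_ν : Injective ν
  injective_mfderiv_ν : ∀ p, Injective (mfderiv ((𝓡 1).prod 𝓘(ℝ, EuclideanSpace ℝ (Fin 2))) 𝓘(ℝ, EuclideanSpace ℝ (Fin 4)) ν p)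
  ν_mem : ∀ p, ν p ∈ modelBoundary k
  ν_zero : ∀ u, ν (u, 0) = K₁ u
  isOpen_flowTube : IsOpen {y : EuclideanSpace ℝ (Fin 4) | (∀ j, (1 : ℝ) / 2 < holeTerm k j y) ∧
    levelFun k y ∈ Ioo (1 - 2 * ε) (1 + 2 * ε) ∧ Φ (1 - levelFun k y, y) ∈ range ν}
  contMDiffOn_ι : ContMDiffOn 𝓘(ℝ, EuclideanSpace ℝ (Fin 4)) ((𝓡 1).prod 𝓘(ℝ, EuclideanSpace ℝ (Fin 2))) ∞ ι {y : EuclideanSpace ℝ (Fin 4) | (∀ j, (1 : ℝ) / 2 < holeTerm k j y) ∧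
    levelFun k y ∈ Ioo (1 - 2 * ε) (1 + 2 * ε) ∧ Φ (1 - levelFun k y, y) ∈ range ν}
  ι_Φ : ∀ (q : (Metric.sphere (0 : EuclideanSpace ℝ (Fin 2)) 1) × (EuclideanSpace ℝ (Fin 2))) (s : ℝ), s ∈ Ioo (-(2 * ε)) (2 * ε) → ι (Φ (s, ν q)) = q
  Φ_ι : ∀ y ∈ {y : EuclideanSpace ℝ (Fin 4) | (∀ j, (1 : ℝ) / 2 < holeTerm k j y) ∧
    levelFun k y ∈ Ioo (1 - 2 * ε) (1 + 2 * ε) ∧ Φ (1 - levelFun k y, y) ∈ range ν}, Φ (levelFun k y - 1, ν (ι y)) = y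

/-- **The clock on the whole band** (the `TraceDatum.clock` shape of `…TkAux3` with `δ = 2ε`): from the clock
`G_k(Φ(s, x)) = 1 + s` along `M_k` (`|s| ≤ 2ε`) and the band clause, every band point `y` (guard `> 1/2`,
`G_k y ∈ (1 - 2ε, 1 + 2ε)`) flows with unit clock speed as long as the level stays in the band: write
`y = Φ(G_k y - 1, a)` with `a = Φ(1 - G_k y, y) ∈ M_k`. [folklore] -/
theorem clock_of_clock {k : ℕ} {Φ : ℝ × (EuclideanSpace ℝ (Fin 4)) → EuclideanSpace ℝ (Fin 4)} {ε : ℝ} (h0 : ∀ x, Φ (0, x) = x)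
    (hadd : ∀ s t x, Φ (s, Φ (t, x)) = Φ (s + t, x))
    (hclock : ∀ x ∈ modelBoundary k, ∀ s : ℝ, |s| ≤ 2 * ε →
      (∀ j, (1 : ℝ) / 2 < holeTerm k j (Φ (s, x))) ∧ levelFun k (Φ (s, x)) = 1 + s)
    (hband : ∀ y, (∀ j, 0 < holeTerm k j y) → |levelFun k y - 1| < 2 * ε → Φ (1 - levelFun k y, y) ∈ modelBoundary k) :
    ∀ y : EuclideanSpace ℝ (Fin 4), (∀ j, (1 : ℝ) / 2 < holeTerm k j y) → levelFun k y ∈ Ioo (1 - 2 * ε) (1 + 2 * ε) →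
      ∀ t : ℝ, levelFun k y + t ∈ Ioo (1 - 2 * ε) (1 + 2 * ε) →
        (∀ j, (1 : ℝ) / 2 < holeTerm k j (Φ (t, y))) ∧ levelFun k (Φ (t, y)) = levelFun k y + t := by
  intro y hy hG t ht
  have hy0 : ∀ j, 0 < holeTerm k j y := fun j => lt_trans (by norm_num) (hy j)
  have hG' : |levelFun k y - 1| < 2 * ε := by rw [abs_lt]; constructor <;> linarith [hG.1, hG.2]
  have ha := hband y hy0 hG'
  have hya : Φ (levelFun k y - 1, Φ (1 - levelFun k y, y)) = y := by
    rw [hadd, show levelFun k y - 1 + (1 - levelFun k y) = 0 by ring, h0]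
  have hs : |t + (levelFun k y - 1)| ≤ 2 * ε := by rw [abs_le]; constructor <;> linarith [ht.1, ht.2]
  obtain ⟨hh, hL⟩ := hclock _ ha (t + (levelFun k y - 1)) hs
  have heq : Φ (t, y) = Φ (t + (levelFun k y - 1), Φ (1 - levelFun k y, y)) := by
    conv_lhs => rw [← hya]
    rw [hadd]
  rw [heq]
  exact ⟨hh, by rw [hL]; ring⟩

namespace CollarDatum

/-- **The collar datum assembled from the hypotheses of `helper_friendsCarrier_Vk_partC`**: the tube
coordinates `ι` on the flow-out of `ν` are those of `helper_friendsCarrier_Tk_tubeChart` for the flow `Φ`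
with `δ = 2ε` (by choice). [folklore] -/
def datumOf {k : ℕ} {K₁ : (Metric.sphere (0 : EuclideanSpace ℝ (Fin 2)) 1) → EuclideanSpace ℝ (Fin 4)} {Φ : ℝ × (EuclideanSpace ℝ (Fin 4)) → EuclideanSpace ℝ (Fin 4)} {ε s₁ s₀ : ℝ} {g : (EuclideanSpace ℝ (Fin 2)) → EuclideanSpace ℝ (Fin 4)}
    {G : (EuclideanSpace ℝ (Fin 2)) × (EuclideanSpace ℝ (Fin 2)) → EuclideanSpace ℝ (Fin 4)} {ν : (Metric.sphere (0 : EuclideanSpace ℝ (Fin 2)) 1) × (EuclideanSpace ℝ (Fin 2)) → EuclideanSpace ℝ (Fin 4)}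
    (hK : IsModelKnot k K₁) (hΦ : ContDiff ℝ ∞ Φ) (hΦ0 : ∀ x, Φ (0, x) = x)
    (hΦadd : ∀ s t x, Φ (s, Φ (t, x)) = Φ (s + t, x)) (hε : 0 < ε) (hε4 : ε ≤ 1 / 4)
    (hclock : ∀ x ∈ modelBoundary k, ∀ s : ℝ, |s| ≤ 2 * ε →
      (∀ j, (1 : ℝ) / 2 < holeTerm k j (Φ (s, x))) ∧ levelFun k (Φ (s, x)) = 1 + s)
    (hband : ∀ y, (∀ j, 0 < holeTerm k j y) → |levelFun k y - 1| < 2 * ε → Φ (1 - levelFun k y, y) ∈ modelBoundary k)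
    (hs₀ : 0 < s₀) (hs₀₁ : s₀ < s₁) (hs₁ε : s₁ < 2 * ε) (hg : IsModelSliceDisc k K₁ g)
    (hgcone : ∀ (u : (Metric.sphere (0 : EuclideanSpace ℝ (Fin 2)) 1)) (t : ℝ), 1 - s₁ ≤ t → t ≤ 1 → g (t • (u : EuclideanSpace ℝ (Fin 2))) = Φ (1 - t, K₁ u))
    (hG : ContDiffOn ℝ ∞ G (ball 0 1 ×ˢ ball 0 2) ∧ InjOn G (ball 0 1 ×ˢ ball 0 2) ∧
      (∀ q ∈ ball 0 1 ×ˢ ball 0 2, Injective (fderiv ℝ G q)) ∧ (∀ q ∈ ball 0 1 ×ˢ ball 0 2, G q ∉ modelHandlebody k) ∧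
      (∀ x ∈ ball 0 1, G (x, 0) = g x))
    (hGcone : ∀ (u : (Metric.sphere (0 : EuclideanSpace ℝ (Fin 2)) 1)) (t : ℝ) (w : EuclideanSpace ℝ (Fin 2)), 1 - s₁ < t → t < 1 → ‖w‖ < 2 → G (t • (u : EuclideanSpace ℝ (Fin 2)), w) = Φ (1 - t, ν (u, w)))
    (hdeep : ∀ (x w : EuclideanSpace ℝ (Fin 2)), ‖x‖ ≤ 1 - s₀ → ‖w‖ < 2 → ∀ a ∈ modelBoundary k, ∀ s : ℝ, 0 < s → s < s₀ → G (x, w) ≠ Φ (s, a))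
    (h3 : ContMDiff ((𝓡 1).prod 𝓘(ℝ, EuclideanSpace ℝ (Fin 2))) 𝓘(ℝ, EuclideanSpace ℝ (Fin 4)) ∞ ν) (h4 : Injective ν)
    (h5 : ∀ p, Injective (mfderiv ((𝓡 1).prod 𝓘(ℝ, EuclideanSpace ℝ (Fin 2))) 𝓘(ℝ, EuclideanSpace ℝ (Fin 4)) ν p))
    (h6 : ∀ p, ν p ∈ modelBoundary k) (h7 : ∀ u : (Metric.sphere (0 : EuclideanSpace ℝ (Fin 2)) 1), ν (u, 0) = K₁ u) : CollarDatum k :=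
  let T := helper_friendsCarrier_Tk_tubeChart k ν Φ (2 * ε) (by linarith) hΦ hΦ0 hΦadd (clock_of_clock hΦ0 hΦadd hclock hband) h3 h4 h5 h6
  { K₁ := K₁, Φ := Φ, ε := ε, s₁ := s₁, s₀ := s₀, g := g, G := G, ν := ν, ι := T.2.choose,
    isModelKnot := hK, contDiff_Φ := hΦ, Φ_zero := hΦ0, Φ_add := hΦadd, ε_pos := hε, ε_le := hε4, clock := hclock,
    band_mem := hband, s₀_pos := hs₀, s₀_lt := hs₀₁, s₁_lt := hs₁ε, isModelSliceDisc := hg, g_cone := hgcone,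
    contDiffOn := hG.1, injOn := hG.2.1, injective_fderiv := hG.2.2.1, not_mem := hG.2.2.2.1, apply_zero := hG.2.2.2.2,
    cone := hGcone, deep := hdeep, contMDiff_ν := h3, injective_ν := h4, injective_mfderiv_ν := h5, ν_mem := h6, ν_zero := h7,
    isOpen_flowTube := T.1, contMDiffOn_ι := T.2.choose_spec.1, ι_Φ := T.2.choose_spec.2.1, Φ_ι := T.2.choose_spec.2.2 }

variable {k : ℕ} (V : CollarDatum k)

/-! ### The flow chart of the band: definitions -/

/-- The open flow band `B = {off the poles} ∩ {|G_k - 1| < 2ε}` around `M_k`. [folklore] -/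
def band : Set (EuclideanSpace ℝ (Fin 4)) := {y | (∀ j : Fin k, 0 < holeTerm k j y) ∧ |levelFun k y - 1| < 2 * V.ε}

/-- The depth `G_k y - 1` of a point (template: `1 - ‖z‖`). [folklore] -/
def _root_.Summit.SmoothPoincare4.SmoothPoincare4.Theorems.DcrGap.MkFriends.FriendsVk.depth (k : ℕ) (y : EuclideanSpace ℝ (Fin 4)) : ℝ := levelFun k y - 1

/-- The drop `Φ(1 - G_k y, y)` of a band point onto `M_k` (template: the direction `z/‖z‖`). [folklore] -/
def drop (y : EuclideanSpace ℝ (Fin 4)) : EuclideanSpace ℝ (Fin 4) := V.Φ (1 - levelFun k y, y)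

/-- The thin shell `Φ((0, s) × M_k)` outside `D_k` (described intrinsically: band points of depth in
`(0, s)`); template: the spherical shell `1 - s < ‖z‖ < 1`. [folklore] -/
def shell (s : ℝ) : Set (EuclideanSpace ℝ (Fin 4)) := {y | y ∈ V.band ∧ 0 < depth k y ∧ depth k y < s}

/-! ### The tube neighbourhood of the open disc, the closed unit tube, the disc -/

/-- The tube neighbourhood `N = G(D̊² × B(0,2))` of the open disc (`ConicalDiscTube.dom = D̊² × B(0,2)`). [folklore] -/
def N : Set (EuclideanSpace ℝ (Fin 4)) := V.G '' ConicalDiscTube.dom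

/-- The inverse of the disc tube on `N` (junk elsewhere). [folklore] -/
def Ginv : EuclideanSpace ℝ (Fin 4) → (EuclideanSpace ℝ (Fin 2)) × (EuclideanSpace ℝ (Fin 2)) := Function.invFunOn V.G ConicalDiscTube.dom

/-- The closed unit tube `ν(𝕊¹ × B̄(0,1)) ⊆ M_k`: directions for which the tube formulas are used. [folklore] -/
def unitTube : Set (EuclideanSpace ℝ (Fin 4)) := V.ν '' ((univ : Set (Metric.sphere (0 : EuclideanSpace ℝ (Fin 2)) 1)) ×ˢ closedBall (0 : EuclideanSpace ℝ (Fin 2)) 1)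

/-- The image `Δ = g(𝔻²)` of the closed disc. [folklore] -/
def disc : Set (EuclideanSpace ℝ (Fin 4)) := V.g '' closedBall (0 : EuclideanSpace ℝ (Fin 2)) 1

/-! ### The collar formulas (template: `ConicalDiscTube.cRad`, `cTube`, `cFlat`, `collar`) -/

/-- **Shell formula** — the collar outside the unit tube: `(a, σ) ↦ Φ(ℓ, a)`, depth `ℓ = Einv s₀ (e^{-σ})`
(template: the radial formula `(1 - ℓ) • a`). [folklore] -/
def cRad (a : EuclideanSpace ℝ (Fin 4)) (σ : ℝ) : EuclideanSpace ℝ (Fin 4) := V.Φ (SliceCollar.Einv V.s₀ (Real.exp (-σ)), a)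

/-- The profile coordinates `(ℓ, r) = Ψ⁻¹ (‖w‖, σ)` over the tube point `a = ν (u, w)`. [folklore] -/
def baseP (a : EuclideanSpace ℝ (Fin 4)) (σ : ℝ) : ℝ × ℝ := SliceCollar.Ψinv V.s₀ (‖(V.ι a).2‖, σ)

/-- The tube point with profile coordinates `(ℓ, r)` and angles `(u, v)`: `G ((1 - ℓ) u, r v)`. [folklore] -/
def ptB (ℓ r : ℝ) (u v : (Metric.sphere (0 : EuclideanSpace ℝ (Fin 2)) 1)) : EuclideanSpace ℝ (Fin 4) := V.G ((1 - ℓ) • (u : EuclideanSpace ℝ (Fin 2)), r • (v : EuclideanSpace ℝ (Fin 2)))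

/-- **Tube formula** `(ν(u, w), σ) ↦ G ((1 - ℓ) u, r ŵ)`, `(ℓ, r) = Ψ⁻¹ (‖w‖, σ)`. [folklore] -/
def cTube (a : EuclideanSpace ℝ (Fin 4)) (σ : ℝ) : EuclideanSpace ℝ (Fin 4) :=
  V.ptB (V.baseP a σ).1 (V.baseP a σ).2 (V.ι a).1 (radialProjection (spherePt 1) (V.ι a).2)

/-- **Flat formula** near the dual knot: `((p, v), σ) ↦ G (4 p, Einv 1 (e^{-σ}) • v)`. [folklore] -/
def cFlat (b : (EuclideanSpace ℝ (Fin 2)) × (Metric.sphere (0 : EuclideanSpace ℝ (Fin 2)) 1)) (σ : ℝ) : EuclideanSpace ℝ (Fin 4) :=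
  V.G ((4 : ℝ) • b.1, SliceCollar.Einv 1 (Real.exp (-σ)) • (b.2 : EuclideanSpace ℝ (Fin 2)))

/-- The shell part of `Y`: points of `M_k` outside the closed unit tube. [folklore] -/
def radSet {Y : Type*} (jM : EuclideanSpace ℝ (Fin 4) → Y) : Set Y := jM '' {a | a ∈ modelBoundary k ∧ a ∉ V.unitTube}

/-- The `M_k`-part of `Y`: points of `M_k` off the knot. [folklore] -/
def mSet {Y : Type*} (jM : EuclideanSpace ℝ (Fin 4) → Y) : Set Y := jM '' {a | a ∈ modelBoundary k ∧ a ∉ range V.K₁}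

open Classical in
/-- **The collar** `Y × ℝ → ℝ⁴` (three formulas on an open cover of `Y × ℝ`). [folklore] -/
def collar {Y : Type*} (jM : EuclideanSpace ℝ (Fin 4) → Y) (jB : ↥solidTorus → Y) (ψ : Y → EuclideanSpace ℝ (Fin 4)) (p : Y × ℝ) : EuclideanSpace ℝ (Fin 4) :=
  if p.1 ∈ V.radSet jM then V.cRad (ψ p.1) p.2
  else if p.1 ∈ V.mSet jM then V.cTube (ψ p.1) p.2
  else V.cFlat (TubeNbhd.invB jB p.1) p.2

/-! ### The inverse formulas (template: `ΨRad`, `ΨTube`, `ΨFlat`, `collarInv`) -/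

/-- **Shell inverse formula** `z ↦ (jM (drop z), -log E_{s₀}(depth z))`. [folklore] -/
def ΨRad {Y : Type*} (jM : EuclideanSpace ℝ (Fin 4) → Y) (z : EuclideanSpace ℝ (Fin 4)) : Y × ℝ := (jM (V.drop z), -Real.log (SliceCollar.E V.s₀ (depth k z)))

/-- The profile values `(τ, h) = Ψ (1 - ‖x‖, ‖w‖)` at the tube point `G (x, w)`. [folklore] -/
def profB (z : EuclideanSpace ℝ (Fin 4)) : ℝ × ℝ := SliceCollar.Ψ V.s₀ (1 - ‖(V.Ginv z).1‖, ‖(V.Ginv z).2‖)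

/-- **Tube inverse formula** `G(x, w) ↦ (jM (ν (x̂, τ ŵ)), h)`. [folklore] -/
def ΨTube {Y : Type*} (jM : EuclideanSpace ℝ (Fin 4) → Y) (z : EuclideanSpace ℝ (Fin 4)) : Y × ℝ :=
  (jM (V.ν (radialProjection (spherePt 1) (V.Ginv z).1,
    (V.profB z).1 • ((radialProjection (spherePt 1) (V.Ginv z).2 : (Metric.sphere (0 : EuclideanSpace ℝ (Fin 2)) 1)) : EuclideanSpace ℝ (Fin 2)))), (V.profB z).2)

/-- **Flat inverse formula** `G(x, w) ↦ (jB (x/4, ŵ), -log E_1(‖w‖))`. [folklore] -/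
def ΨFlat {Y : Type*} (jB : ↥solidTorus → Y) (z : EuclideanSpace ℝ (Fin 4)) : Y × ℝ :=
  (TubeNbhd.jBt jB ((4 : ℝ)⁻¹ • (V.Ginv z).1, radialProjection (spherePt 1) (V.Ginv z).2),
    -Real.log (SliceCollar.E 1 ‖(V.Ginv z).2‖))

/-- The shell region: points of the thin shell `Φ((0, s₀) × M_k)` whose drop is outside the closed unit tube
(template: `1 - s₀ < ‖z‖`, `z/‖z‖ ∉ unitTube`). [folklore] -/
def radSetT : Set (EuclideanSpace ℝ (Fin 4)) := {z | z ∈ V.shell V.s₀ ∧ V.drop z ∉ V.unitTube}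

open Classical in
/-- **The inverse collar** `ℝ⁴ → Y × ℝ` (meaningful on the collar region). [folklore] -/
def collarInv {Y : Type*} (jM : EuclideanSpace ℝ (Fin 4) → Y) (jB : ↥solidTorus → Y) (z : EuclideanSpace ℝ (Fin 4)) : Y × ℝ :=
  if z ∈ V.radSetT then V.ΨRad jM z
  else if (V.Ginv z).1 ≠ 0 then V.ΨTube jM z
  else V.ΨFlat jB z

/-! ### The collar region, the exterior, the size function -/

/-- **The collar region** (the image of the collar): the thin shell off the disc together with the punctured
unit tube of the open disc (template: `B̊⁴ ∖ Δ ∖ core`). [folklore] -/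
def region : Set (EuclideanSpace ℝ (Fin 4)) := {z | z ∈ V.shell V.s₀ ∧ z ∉ V.disc} ∪ V.G '' (ball (0 : EuclideanSpace ℝ (Fin 2)) 1 ×ˢ (ball (0 : EuclideanSpace ℝ (Fin 2)) 1 \ {0}))

/-- **The exterior** `E = ℝ⁴ ∖ (D_k ∪ Δ)` (the set of the `Opens` of `helper_friendsCarrier_Vk_partC`). [folklore] -/
def O : Set (EuclideanSpace ℝ (Fin 4)) := {x | x ∉ modelHandlebody k ∧ x ∉ V.g '' closedBall (0 : EuclideanSpace ℝ (Fin 2)) 1}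

open Classical in
/-- The normal-radius part of the size: `E_1 (‖w‖)` at `G (x, w)`, `0` off the tube neighbourhood. [folklore] -/
def χ (z : EuclideanSpace ℝ (Fin 4)) : ℝ := if z ∈ V.N then SliceCollar.E 1 ‖(V.Ginv z).2‖ else 0

open Classical in
/-- The depth part of the size: `E_{s₀} (depth z)` on the shell `Φ((0, 2ε) × M_k)`, `0` elsewhere
(template: `E_{s₀}(1 - ‖z‖)`). [folklore] -/
def ρ (z : EuclideanSpace ℝ (Fin 4)) : ℝ := if z ∈ V.shell (2 * V.ε) then SliceCollar.E V.s₀ (depth k z) else 0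

/-- **The size function** `M = ρ + χ` (`= e^{-σ}` on the collar region, `= 0` on the rest of the exterior). [folklore] -/
def M (z : EuclideanSpace ℝ (Fin 4)) : ℝ := V.ρ z + V.χ z

/-! ### Coordinate form of the tube formula; the parts of `Y`; regime sets -/

/-- The tube formula in tube coordinates `((u, w), σ) ↦ G ((1 - ℓ) u, r ŵ)`, `(ℓ, r) = Ψ⁻¹ (‖w‖, σ)`. [folklore] -/
def fP (q : ((Metric.sphere (0 : EuclideanSpace ℝ (Fin 2)) 1) × EuclideanSpace ℝ (Fin 2)) × ℝ) : EuclideanSpace ℝ (Fin 4) :=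
  V.G ((1 - (SliceCollar.Ψinv V.s₀ (‖q.1.2‖, q.2)).1) • ((q.1.1 : (Metric.sphere (0 : EuclideanSpace ℝ (Fin 2)) 1)) : EuclideanSpace ℝ (Fin 2)),
    (SliceCollar.Ψinv V.s₀ (‖q.1.2‖, q.2)).2 • ((radialProjection (spherePt 1) q.1.2 : (Metric.sphere (0 : EuclideanSpace ℝ (Fin 2)) 1)) : EuclideanSpace ℝ (Fin 2)))

/-- The tube part of `Y`: points of `M_k ∖ K₁` in the tube `ν(𝕊¹ × B(0,2))`. [folklore] -/
def tubeSet {Y : Type*} (jM : EuclideanSpace ℝ (Fin 4) → Y) : Set Y :=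
  jM '' {a | a ∈ modelBoundary k ∧ a ∉ range V.K₁ ∧ a ∈ V.ν '' ((univ : Set (Metric.sphere (0 : EuclideanSpace ℝ (Fin 2)) 1)) ×ˢ ball (0 : EuclideanSpace ℝ (Fin 2)) 2)}

/-- The flat part of `Y`: the solid-torus points with `‖p‖ < (1 - s₀)/4`. [folklore] -/
def flatSetY {Y : Type*} (jB : ↥solidTorus → Y) : Set Y :=
  jB '' {b | ‖(b : (EuclideanSpace ℝ (Fin 2)) × (Metric.sphere (0 : EuclideanSpace ℝ (Fin 2)) 1)).1‖ < (1 - V.s₀) / 4}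

/-- The tube-regime set of the tube coordinates of the open disc. [folklore] -/
def Pset : Set ((EuclideanSpace ℝ (Fin 2)) × (EuclideanSpace ℝ (Fin 2))) :=
  {q | q ∈ (ConicalDiscTube.dom : Set ((EuclideanSpace ℝ (Fin 2)) × (EuclideanSpace ℝ (Fin 2)))) ∧ q.1 ≠ 0 ∧ q.2 ≠ 0 ∧ (1 - ‖q.1‖, ‖q.2‖) ∈ SliceCollar.P V.s₀}

/-- The flat-regime set of the tube coordinates of the open disc. [folklore] -/
def Fset : Set ((EuclideanSpace ℝ (Fin 2)) × (EuclideanSpace ℝ (Fin 2))) := {q | ‖q.1‖ < 1 - V.s₀ ∧ q.2 ≠ 0 ∧ ‖q.2‖ < 1}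

/-! ### Presentations of `Y` as `M_k` surgered along `K₁` through `ν` -/

/-- **A smooth presentation of `Y` as `M_k` surgered along `K₁` through the tube `ν`** (the `Y`-side
hypothesis block of `helper_friendsCarrier_Vk_partC`, bundled; the T_k port's `SmoothPresentation`): `jM`
on `M_k ∖ K₁`, smooth on an open `W ⊇ M_k ∖ K₁` with open image and smooth inverse `ψ`, the smoothly
embedded open solid torus `jB`, covering `Y`, glued by `jM (ν(u, t v)) = jB (t u, v)`, `0 < t < 1`. [folklore] -/
structure Pres (Y : Type*) [TopologicalSpace Y] [ChartedSpace (EuclideanSpace ℝ (Fin 3)) Y] where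
  /-- the presentation of `M_k ∖ K₁` (total on `ℝ⁴`) -/
  jM : EuclideanSpace ℝ (Fin 4) → Y
  /-- the surgery solid torus -/
  jB : ↥solidTorus → Y
  /-- an open set of `ℝ⁴` containing `M_k ∖ K₁` on which `jM` is smooth -/
  W : Set (EuclideanSpace ℝ (Fin 4))
  /-- the inverse of `jM` (total on `Y`) -/
  ψ : Y → EuclideanSpace ℝ (Fin 4)
  jB_emb : Manifold.IsSmoothEmbedding (𝓘(ℝ, EuclideanSpace ℝ (Fin 2)).prod (𝓡 1)) (𝓡 3) ∞ jB
  isOpen_range_jB : IsOpen (range jB)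
  isOpen_W : IsOpen W
  mem_W : ∀ x ∈ modelBoundary k, x ∉ range V.K₁ → x ∈ W
  contMDiffOn_jM : ContMDiffOn 𝓘(ℝ, EuclideanSpace ℝ (Fin 4)) (𝓡 3) ∞ jM W
  isOpen_mSet : IsOpen (jM '' {x : EuclideanSpace ℝ (Fin 4) | x ∈ modelBoundary k ∧ x ∉ range V.K₁})
  contMDiffOn_ψ : ContMDiffOn (𝓡 3) 𝓘(ℝ, EuclideanSpace ℝ (Fin 4)) ∞ ψ (jM '' {x : EuclideanSpace ℝ (Fin 4) | x ∈ modelBoundary k ∧ x ∉ range V.K₁})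
  ψ_jM : ∀ x ∈ modelBoundary k, x ∉ range V.K₁ → ψ (jM x) = x
  cover : jM '' {x : EuclideanSpace ℝ (Fin 4) | x ∈ modelBoundary k ∧ x ∉ range V.K₁} ∪ range jB = univ
  rel : ∀ x ∈ modelBoundary k, x ∉ range V.K₁ → ∀ b : ↥solidTorus, jM x = jB b ↔
    ∃ (u : (Metric.sphere (0 : EuclideanSpace ℝ (Fin 2)) 1)) (t : ℝ), t ∈ Ioo (0 : ℝ) 1 ∧ b.1.1 = t • (u : EuclideanSpace ℝ (Fin 2)) ∧ x = V.ν (u, t • (b.1.2 : EuclideanSpace ℝ (Fin 2)))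

end CollarDatum

end FriendsVk

/-- **Helper `helper_friendsCarrier_Vk_partC_clock`** (registered piece 1 of `helper_friendsCarrier_Vk_partC`,
line `mk_friends`, crux `DcrGap`): for a complete flow `Φ` of `ℝ⁴` with the clock `G_k(Φ(s, x)) = 1 + s`
along `M_k` (`|s| ≤ 2ε`) and the band clause, (i) the clock holds on the whole band in the `TraceDatum`
shape (`δ = 2ε`), so that the tube coordinates of `helper_friendsCarrier_Tk_tubeChart` exist for `Φ`, and
(ii) the flow-out of `M_k` meets `D_k` exactly for nonpositive times: `Φ(s, a) ∈ D_k ↔ s ≤ 0`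
(`a ∈ M_k`, `|s| < 2ε`, `ε ≤ 1/4`). [folklore] -/
theorem helper_friendsCarrier_Vk_partC_clock : ∀ (k : ℕ) (Φ : ℝ × EuclideanSpace ℝ (Fin 4) → EuclideanSpace ℝ (Fin 4)) (ε : ℝ), (∀ x, Φ (0, x) = x) → (∀ s t x, Φ (s, Φ (t, x)) = Φ (s + t, x)) → 0 < ε → ε ≤ 1 / 4 → (∀ x ∈ modelBoundary k, ∀ s : ℝ, |s| ≤ 2 * ε → (∀ j, (1 : ℝ) / 2 < holeTerm k j (Φ (s, x))) ∧ levelFun k (Φ (s, x)) = 1 + s) → (∀ y, (∀ j, 0 < holeTerm k j y) → |levelFun k y - 1| < 2 * ε → Φ (1 - levelFun k y, y) ∈ modelBoundary k) → (∀ y : EuclideanSpace ℝ (Fin 4), (∀ j, (1 : ℝ) / 2 < holeTerm k j y) → levelFun k y ∈ Ioo (1 - 2 * ε) (1 + 2 * ε) → ∀ t : ℝ, levelFun k y + t ∈ Ioo (1 - 2 * ε) (1 + 2 * ε) → (∀ j, (1 : ℝ) / 2 < holeTerm k j (Φ (t, y))) ∧ levelFun k (Φ (t, y)) = levelFun k y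 + t) ∧ (∀ a ∈ modelBoundary k, ∀ s : ℝ, |s| < 2 * ε → (Φ (s, a) ∈ modelHandlebody k ↔ s ≤ 0)) := by
  intro k Φ ε h0 hadd hε hε4 hclock hband
  refine ⟨FriendsVk.clock_of_clock h0 hadd hclock hband, fun a ha s hs => ?_⟩
  obtain ⟨hh, hG⟩ := hclock a ha s hs.le
  constructor
  · intro h; linarith [h.2]
  · intro h
    exact FriendsCarrierVk.mem_modelHandlebody_of_half_le (fun j => (hh j).le) (by rw [hG]; linarith)

end Summit.SmoothPoincare4.SmoothPoincare4.Theorems.DcrGap.MkFriends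

end
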